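import Summits.QuantumFields.YangMills.Theorems.BalabanUVNodesK0RecordFormatNamesLocC

/-!
# K0⁷ record FORMAT⁺ names — lemma file 11: faces of EDITIONS 16 ∕ 16b ∕ 16c (the □₀-localized response, RC-3 (H′-lin))

Companion of `…K0RecordFormatNamesLoc ∕ LocB ∕ LocC`.  Kernel-checked bookkeeping; nothing of Bałaban's asserted.  DEFINER seat `ym-nodeO-def-1` (gen 34);
`--kind proof --supports stmt-QuantumFields-20541 --as helper`; count-neutral.

* §1 the projection lemmas of the guarded receipts `Response9DLocW` (inner guard + per-member no-wrap guards) and `Response9DLoc` (inner guard), and the WEAKENINGS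
  `Response9D → Response9DLoc → Response9DLocW` (a guard only weakens a row).
* §2 the `rfl` bridges between ed.16b's Mc-instanced nest and ed.16c's radius-generic packaging: `recordWindowLoc = recordWindow (nestRadius Mc 5)`, `innerCube = recordWindow
  (nestRadius Mc 3)`, `WindowNoWrap ↔ NoWrapAt (nestRadius Mc 5)`, `InInnerCube ↔ · ∈ recordWindow (nestRadius Mc 3)`, and the receipt `Response9DLocAt` AT the nest radii unfolded
  to `Response9DLocW` over `InInnerCube ∕ WindowNoWrap` (`Iff.rfl`) — what the ⁷⁗ cutter and SkeletonV11 read.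
* §3 monotonicity of windows and guards: `windowSites` grows with the radius, `innerCube ⊆ recordWindowLoc`, `NoWrapAt` shrinks with the radius.
* §4 units: `windowRespξ = ξ · windowResp`, `recordHrLocξ = ξ · recordHrLoc` entrywise (N-1 SAID in kernel); off the standing range the window response is `0`; the chart-unit
  linear representation on a basis field is the single label's term.

HONEST FRAMING.  Bookkeeping; the decay of the domain propagator on □₃, the per-member transport lemma ((R4ᴰ-Loc) with left side `0`) and (E4a)-Locξ are NOT proved here (porters');
27931 ⁷⁗ not yet cut∕signed; K0⁷ NOT closed; NODE O 0∕1; COUNT 8∕28 · K 1∕4 UNMOVED; finite 𝕋⁴ at fixed ε — not continuum ∕ OS ∕ Clay; the Yang–Mills mass gap is NOT proved by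
any of this.
-/

noncomputable section

open scoped BigOperators Matrix.Norms.L2Operator

namespace Summit.QuantumFields.YangMills.Theorems.K0RecordFormatNames

open Literature.MathematicalPhysics.QuantumFieldTheory.Balaban1983to89
open Literature.MathematicalPhysics.QuantumFieldTheory.Balaban1983to89.Node00
open Literature.MathematicalPhysics.QuantumFieldTheory.Balaban1983to89.T4Continuum (T4Family)
open Literature.MathematicalPhysics.QuantumFieldTheory.Balaban1983to89.B12FormatPlus (cutTo restrictCLM Response9D)

/-! ## §1  Projections and weakenings of the guarded receipts -/

section Generic

variable {S : ℕ → LocDomainSys} {M m : ℕ → ℕ} {d : ℕ} {R : B12FormatPlus.Response9Data S M m d}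
  {χ : (n : ℕ) → (S n).Dom → (Fin (m n) → ℂ) → (Fin (M n) → ℂ)} {N : ℕ → ℕ} {D : (n : ℕ) → (S n).Dom → Set (Fin (m n) → ℂ)}
  {inner : (n : ℕ) → R.Λ n → Prop} {nowrap : ℕ → Prop} {C₉ δ₀ : ℝ}

/-- (R0) of `Response9DLocW`: the constants are non-negative. [cite: Balaban1985Variational, Prop. 9 p.309 (bookkeeping)] -/
theorem Response9DLocW.consts_nonneg (h : Response9DLocW R χ N D inner nowrap C₉ δ₀) : 0 ≤ C₉ ∧ 0 ≤ δ₀ := ⟨h.1, h.2.1⟩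

/-- (R1ᴰ-Loc) of `Response9DLocW`: in a non-wrapping member, for a domain whose chart inputs carry labels in the inner region, the gauge of the cut response decays in the distance
of the label to the domain. [cite: Balaban1985Variational, Prop. 9 p.309, (190) p.308; Balaban1987RG1, (4.5) p.282, p.274 L9–13] -/
theorem Response9DLocW.decay (h : Response9DLocW R χ N D inner nowrap C₉ δ₀) (n : ℕ) (X : (S n).Dom) (y : R.Λ n) (hn : nowrap n)
    (hX : ∀ i ∈ R.cX n X, inner n (R.siteOf n i)) :
    gauge (D n X) (cutTo (R.cX n X) (R.Gk n y)) ≤ C₉ * Real.exp (-δ₀ * (R.G n).distD y X) :=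
  h.2.2.1 n X y hn hX

/-- (R3) of `Response9DLocW`: unwrap compatibility of the chart-index lift. [cite: Balaban1987RG1, (1.21) p.264] -/
theorem Response9DLocW.unwrap (h : Response9DLocW R χ N D inner nowrap C₉ δ₀) (n : ℕ) (X : (S n).Dom) (hX : X ∉ R.wrap n)
    (i : Fin (m n)) (hi : i ∈ R.cX n X) : R.jX n X i ∈ R.cX (n + 1) (R.emb n X) :=
  h.2.2.2.1 n X hX i hi

/-- (R4ᴰ-Loc) of `Response9DLocW`: the two-volume response comparison, under the no-wrap guards of members `n` and `n + 1`. [cite: Balaban1987RG1, (1.21) p.264, (4.35) p.290] -/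
theorem Response9DLocW.twoVol (h : Response9DLocW R χ N D inner nowrap C₉ δ₀) (n : ℕ) (X : (S n).Dom) (hX : X ∉ R.wrap n) (hn : nowrap n)
    (hn' : nowrap (n + 1)) (μ : Fin d) (z : Fin d → ℤ) (hz : ∀ l, 2 * |z l| < (N n : ℤ)) :
    gauge (D n X) (cutTo (R.cX n X) fun i => R.Gk (n + 1) (R.e (n + 1) μ z) (R.jX n X i) - R.Gk n (R.e n μ z) i) ≤
      C₉ * Real.exp (-δ₀ * (N n : ℝ) / 2) * Real.exp (-(δ₀ / 2) * (R.G n).distD (R.e n μ z) X) :=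
  h.2.2.2.2.1 n X hX hn hn' μ z hz

/-- (R5) of `Response9DLocW`: chart intertwining. [cite: Balaban1987RG1, (4.35) p.290, (1.21) p.264] -/
theorem Response9DLocW.intertwine (h : Response9DLocW R χ N D inner nowrap C₉ δ₀) (n : ℕ) (X : (S n).Dom) (hX : X ∉ R.wrap n)
    (w' : Fin (m (n + 1)) → ℂ) : R.πc n X (χ (n + 1) (R.emb n X) w') = χ n X (restrictCLM (R.cX n X) (R.jX n X) w') :=
  h.2.2.2.2.2 n X hX w'

/-- (R0) of `Response9DLoc`. [cite: Balaban1985Variational, Prop. 9 p.309 (bookkeeping)] -/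
theorem Response9DLoc.consts_nonneg (h : Response9DLoc R χ N D inner C₉ δ₀) : 0 ≤ C₉ ∧ 0 ≤ δ₀ := ⟨h.1, h.2.1⟩

/-- (R1ᴰ-Loc) of `Response9DLoc`: the input-guarded decay row. [cite: Balaban1985Variational, Prop. 9 p.309; Balaban1987RG1, (4.5) p.282] -/
theorem Response9DLoc.decay (h : Response9DLoc R χ N D inner C₉ δ₀) (n : ℕ) (X : (S n).Dom) (y : R.Λ n) (hX : ∀ i ∈ R.cX n X, inner n (R.siteOf n i)) :
    gauge (D n X) (cutTo (R.cX n X) (R.Gk n y)) ≤ C₉ * Real.exp (-δ₀ * (R.G n).distD y X) :=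
  h.2.2.1 n X y hX

/-- (R3) of `Response9DLoc`. [cite: Balaban1987RG1, (1.21) p.264] -/
theorem Response9DLoc.unwrap (h : Response9DLoc R χ N D inner C₉ δ₀) (n : ℕ) (X : (S n).Dom) (hX : X ∉ R.wrap n) (i : Fin (m n)) (hi : i ∈ R.cX n X) :
    R.jX n X i ∈ R.cX (n + 1) (R.emb n X) :=
  h.2.2.2.1 n X hX i hi

/-- (R4ᴰ) of `Response9DLoc` (unguarded two-volume row, verbatim from `Response9D`). [cite: Balaban1987RG1, (1.21) p.264] -/
theorem Response9DLoc.twoVol (h : Response9DLoc R χ N D inner C₉ δ₀) (n : ℕ) (X : (S n).Dom) (hX : X ∉ R.wrap n) (μ : Fin d) (z : Fin d → ℤ)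
    (hz : ∀ l, 2 * |z l| < (N n : ℤ)) :
    gauge (D n X) (cutTo (R.cX n X) fun i => R.Gk (n + 1) (R.e (n + 1) μ z) (R.jX n X i) - R.Gk n (R.e n μ z) i) ≤
      C₉ * Real.exp (-δ₀ * (N n : ℝ) / 2) * Real.exp (-(δ₀ / 2) * (R.G n).distD (R.e n μ z) X) :=
  h.2.2.2.2.1 n X hX μ z hz

/-- (R5) of `Response9DLoc`. [cite: Balaban1987RG1, (4.35) p.290] -/
theorem Response9DLoc.intertwine (h : Response9DLoc R χ N D inner C₉ δ₀) (n : ℕ) (X : (S n).Dom) (hX : X ∉ R.wrap n) (w' : Fin (m (n + 1)) → ℂ) :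
    R.πc n X (χ (n + 1) (R.emb n X) w') = χ n X (restrictCLM (R.cX n X) (R.jX n X) w') :=
  h.2.2.2.2.2 n X hX w'

/-- WEAKENING: the unguarded `Response9D` implies the input-guarded `Response9DLoc` for every region `inner`. [cite: Balaban1985Variational, Prop. 9 p.309 (bookkeeping)] -/
theorem response9DLoc_of_response9D (inner : (n : ℕ) → R.Λ n → Prop) (h : Response9D R χ N D C₉ δ₀) : Response9DLoc R χ N D inner C₉ δ₀ :=
  ⟨h.1, h.2.1, fun n X y _ => h.2.2.1 n X y, h.2.2.2.1, h.2.2.2.2.1, h.2.2.2.2.2⟩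

/-- WEAKENING: `Response9DLoc` implies `Response9DLocW` for every per-member guard `nowrap`. [cite: Balaban1985Variational, Prop. 9 p.309 (bookkeeping)] -/
theorem response9DLocW_of_response9DLoc (nowrap : ℕ → Prop) (h : Response9DLoc R χ N D inner C₉ δ₀) : Response9DLocW R χ N D inner nowrap C₉ δ₀ :=
  ⟨h.1, h.2.1, fun n X y _ hX => h.2.2.1 n X y hX, h.2.2.2.1, fun n X hX _ _ => h.2.2.2.2.1 n X hX, h.2.2.2.2.2⟩

/-- WEAKENING: the unguarded `Response9D` implies `Response9DLocW` for every `inner`, `nowrap`. [cite: Balaban1985Variational, Prop. 9 p.309 (bookkeeping)] -/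
theorem response9DLocW_of_response9D (inner : (n : ℕ) → R.Λ n → Prop) (nowrap : ℕ → Prop) (h : Response9D R χ N D C₉ δ₀) :
    Response9DLocW R χ N D inner nowrap C₉ δ₀ :=
  response9DLocW_of_response9DLoc nowrap (response9DLoc_of_response9D inner h)

end Generic

/-! ## §2  The `rfl` bridges: ed.16b's Mc-instanced nest = ed.16c's radius-generic packaging at `R0 := nestRadius Mc 5`, `R3 := nestRadius Mc 3` -/

variable (F : T4Family)

/-- □₀ of the nest IS the radius-`6Mc` window. [cite: Balaban1987RG1, p.273 (□₀ = □₅)] -/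
theorem recordWindowLoc_eq (Mc k K : ℕ) (z₀ : Fin 4 → ℤ) : recordWindowLoc F Mc k K z₀ = recordWindow F k K (nestRadius Mc 5) z₀ := rfl

/-- □₃ of the nest IS the radius-`4Mc` window. [cite: Balaban1987RG1, p.274 L8–9] -/
theorem innerCube_eq (Mc k K : ℕ) (z₀ : Fin 4 → ℤ) : innerCube F Mc k K z₀ = recordWindow F k K (nestRadius Mc 3) z₀ := rfl

/-- The nest's no-wrap condition IS `NoWrapAt` at the radius `6Mc`. [cite: Balaban1987RG1, (1.21) p.264] -/
theorem windowNoWrap_iff (Mc k K : ℕ) (z₀ : Fin 4 → ℤ) : WindowNoWrap F Mc k K z₀ ↔ NoWrapAt F k K (nestRadius Mc 5) z₀ := Iff.rfl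

/-- The □₃ guard IS membership in the radius-`4Mc` window. [cite: Balaban1987RG1, p.274 L9–13] -/
theorem inInnerCube_iff (Mc k K : ℕ) (z₀ : Fin 4 → ℤ) (l : RespLabel F k K) : InInnerCube F Mc k K z₀ l ↔ l.2 ∈ recordWindow F k K (nestRadius Mc 3) z₀ := Iff.rfl

/-- ★ THE RECEIPT AT THE NEST RADII, unfolded: `Response9DLocAt … (nestRadius Mc 5) (nestRadius Mc 3) z₀ …` IS `Response9DLocW` for the chart-unit data at □₀ with the □₃ guard
`InInnerCube` and the per-member guard `WindowNoWrap` (what ⁷⁗ (C1) and SkeletonV11 read). [cite: Balaban1987RG1, (4.35) p.290, (4.4) p.281; Balaban1985Variational, Prop. 9 p.309] -/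
theorem response9DLocAt_nest_iff (θ : Stage13Params F 2) (a : θ.ιβ) (Mc k K₀ : ℕ) (z₀ : Fin 4 → ℤ) (α₂ C₉ δ₀ : ℝ) :
    Response9DLocAt F θ a Mc k K₀ (nestRadius Mc 5) (nestRadius Mc 3) z₀ α₂ C₉ δ₀ ↔
      Response9DLocW (recordResponse9DataFromLocAtξ F θ a Mc k K₀ (nestRadius Mc 5) z₀) (fun n => recordChartJ F Mc k (K₀ + n))
        (fun n => recordRNat F Mc k (K₀ + n)) (fun n X => recordDom44J F Mc k (K₀ + n) X α₂) (fun n l => InInnerCube F Mc k (K₀ + n) z₀ l)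
        (fun n => WindowNoWrap F Mc k (K₀ + n) z₀) C₉ δ₀ :=
  Iff.rfl

/-- The chart-unit response at the term's window, unfolded. [cite: Balaban1987RG1, (4.35) p.290 (bookkeeping)] -/
theorem recordGkLocAtξ_eq (θ : Stage13Params F 2) (k K R0 : ℕ) (z₀ : Fin 4 → ℤ) (a : θ.ιβ) (l : RespLabel F k K) (i : Fin (recordChartDimJ F K)) :
    recordGkLocAtξ F θ k K R0 z₀ a l i = recordGkLocWξ F θ k K (recordWindow F k K R0 z₀) a l i := rfl

/-! ## §3  Monotonicity of windows and guards -/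

/-- A larger radius gives a larger cube window. [cite: Balaban1987RG1, p.270 (bookkeeping)] -/
theorem windowSites_mono (k K : ℕ) {R R' : ℕ} (h : R ≤ R') (y₀ : Site (F.P K) (k + 1)) : windowSites F k K R y₀ ⊆ windowSites F k K R' y₀ := by
  intro y hy
  simp only [windowSites, Finset.mem_filter, Finset.mem_univ, true_and] at hy ⊢
  exact fun μ => (hy μ).trans h

/-- The nest radii increase along the nest. [cite: Balaban1987RG1, p.274 L8–9 (bookkeeping)] -/
theorem nestRadius_mono (Mc : ℕ) {i j : Fin 6} (h : i ≤ j) : nestRadius Mc i ≤ nestRadius Mc j :=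
  Nat.mul_le_mul_right Mc (by simpa using h)

/-- The nest is increasing: `cubeNest i ⊆ cubeNest j` for `i ≤ j`. [cite: Balaban1987RG1, p.274 L8–9] -/
theorem cubeNest_mono (Mc k K : ℕ) (z₀ : Fin 4 → ℤ) {i j : Fin 6} (h : i ≤ j) : cubeNest F Mc k K z₀ i ⊆ cubeNest F Mc k K z₀ j :=
  windowSites_mono F k K (nestRadius_mono Mc h) _

/-- □₃ ⊆ □₀. [cite: Balaban1987RG1, p.274 L8–9] -/
theorem innerCube_subset_recordWindowLoc (Mc k K : ℕ) (z₀ : Fin 4 → ℤ) : innerCube F Mc k K z₀ ⊆ recordWindowLoc F Mc k K z₀ :=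
  cubeNest_mono F Mc k K z₀ (by decide)

/-- The generic windows are nested in the radius. [cite: Balaban1987RG1, p.270 (bookkeeping)] -/
theorem recordWindow_mono (k K : ℕ) {R R' : ℕ} (h : R ≤ R') (z₀ : Fin 4 → ℤ) : recordWindow F k K R z₀ ⊆ recordWindow F k K R' z₀ :=
  windowSites_mono F k K h _

/-- The no-wrap guard is inherited by smaller radii. [cite: Balaban1987RG1, (1.21) p.264 (bookkeeping)] -/
theorem NoWrapAt.mono {k K R R' : ℕ} {z₀ : Fin 4 → ℤ} (h : R ≤ R') (hw : NoWrapAt F k K R' z₀) : NoWrapAt F k K R z₀ := by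
  intro μ
  have := hw μ
  have hR : (R : ℤ) ≤ (R' : ℤ) := by exact_mod_cast h
  linarith

/-! ## §4  Units (N-1 in kernel) and elementary faces -/

/-- N-1: the chart-unit scalar response is `ξ = L^{−(k+1)}` times print's `H(□₀)` response. [cite: Balaban1987RG1, (1.1) p.260, (4.2) p.281] -/
theorem windowRespξ_eq (k K : ℕ) (W : Finset (Site (F.P K) (k + 1))) (l : RespLabel F k K) (b : PBond (F.P K) 0) :
    windowRespξ F k K W l b = (F.P K).eta (k + 1) * windowResp F k K W l b := rfl

/-- N-1 entrywise: `recordHrLocξ = ξ · recordHrLoc`. [cite: Balaban1987RG1, (1.1) p.260, (3.37) p.277] -/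
theorem recordHrLocξ_apply (θ : Stage13Params F 2) (k K : ℕ) (W : Finset (Site (F.P K) (k + 1))) (a : θ.ιβ) (l : RespLabel F k K)
    (b : PBond (F.P K) 0) (i i' : Fin 2) :
    recordHrLocξ F θ k K W a l b i i' = ((F.P K).eta (k + 1) : ℂ) * recordHrLoc F θ k K W a l b i i' := by
  simp only [recordHrLocξ, recordHrLoc, windowRespξ, Complex.ofReal_mul, mul_assoc]

/-- Off the standing range `k + 1 ≤ m + K` the window response is `0` (no junk). [cite: Balaban1984PropagatorsII, (2.1) p.224 (bookkeeping)] -/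
theorem windowResp_of_not_le {k K : ℕ} (h : ¬ k + 1 ≤ (F.P K).m + (F.P K).K) (W : Finset (Site (F.P K) (k + 1))) (l : RespLabel F k K)
    (b : PBond (F.P K) 0) : windowResp F k K W l b = 0 := by
  unfold windowResp
  rw [dif_neg h]

/-- Off the standing range the chart-unit response is `0` too. [cite: Balaban1984PropagatorsII, (2.1) p.224 (bookkeeping)] -/
theorem windowRespξ_of_not_le {k K : ℕ} (h : ¬ k + 1 ≤ (F.P K).m + (F.P K).K) (W : Finset (Site (F.P K) (k + 1))) (l : RespLabel F k K)
    (b : PBond (F.P K) 0) : windowRespξ F k K W l b = 0 := by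
  simp [windowRespξ, windowResp_of_not_le F h]

/-- The chart-unit linear representation on a BASIS FIELD `δ_l ⊗ v` is the single label's term `ξ·windowResp W l b · ρ₈(v)`. [cite: Balaban1987RG1, (4.2) p.281 (bookkeeping)] -/
theorem recordALocξ_single (θ : Stage13Params F 2) (k K : ℕ) (W : Finset (Site (F.P K) (k + 1))) (l : RespLabel F k K) (v : θ.Vβ) (b : PBond (F.P K) 0) :
    letI := θ.instVβ₁; letI := θ.instVβ₂
    recordALocξ F θ k K W (Pi.single l.1 (Pi.single l.2 v)) b = (windowRespξ F k K W l b : ℂ) • θ.ρ8 v := by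
  letI := θ.instVβ₁; letI := θ.instVβ₂
  classical
  unfold recordALocξ
  rw [Fintype.sum_eq_single l]
  · simp
  · intro l' hl'
    have h0 : (Pi.single l.1 (Pi.single l.2 v) : Fin (F.P K).d → Site (F.P K) (k + 1) → θ.Vβ) l'.1 l'.2 = 0 := by
      by_cases h1 : l'.1 = l.1
      · have h2 : l'.2 ≠ l.2 := fun h2 => hl' (Prod.ext h1 h2)
        rw [h1, Pi.single_eq_same, Pi.single_eq_of_ne h2]
      · rw [Pi.single_eq_of_ne h1, Pi.zero_apply]
    rw [h0, map_zero, smul_zero]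

/-- Hence on a basis field `δ_l ⊗ bV a` the chart-unit linear representation IS the matrix of `recordHrLocξ … a l`. [cite: Balaban1987RG1, (4.2) p.281, (3.37) p.277] -/
theorem recordALocξ_basis (θ : Stage13Params F 2) (k K : ℕ) (W : Finset (Site (F.P K) (k + 1))) (a : θ.ιβ) (l : RespLabel F k K) (b : PBond (F.P K) 0) (i i' : Fin 2) :
    letI := θ.instVβ₁; letI := θ.instVβ₂
    recordALocξ F θ k K W (Pi.single l.1 (Pi.single l.2 (θ.bV a))) b i i' = recordHrLocξ F θ k K W a l b i i' := by
  rw [recordALocξ_single]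
  simp [recordHrLocξ, Matrix.smul_apply]

end Summit.QuantumFields.YangMills.Theorems.K0RecordFormatNames

end
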